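import Summits.HubbardSuperconductivity.HubbardSuperconductivity.Theorems.AnisotropyChordTwoMagnonSector
import Summits.HubbardSuperconductivity.HubbardSuperconductivity.Theorems.AnisotropyChordXXZHoppingFormula
import Summits.HubbardSuperconductivity.HubbardSuperconductivity.Theorems.AnisotropyChordConcavityOneMagnonCoordinates

/-!
# Route `AnisotropyChord`: the two-magnon sector of the spin-½ XXZ model on a finite graph, II —
# action, energy, norm, variational principle and condensate in pair coordinates

Continuation of `…TwoMagnonSector`.  For `ψ` supported on the weight-`2` configurations of a finite
simple graph `G` (pair amplitudes `v_{ij} = ψ(e_i + e_j)`, symmetric in `i, j`):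

* `pair_comp_swap`: `(e_i + e_j) ∘ swap_{xy} = e_{s i} + e_{s j}` (`s = swap_{xy}`);
* `xxz_mulVec_pair`: `(H(Δ)ψ)(e_i+e_j) = −Δ Z_{ij} v_{ij} − ¼ Σ_x Σ_y [x∼y][exactly one of x,y ∈ {i,j}]
  v_{s i, s j}` (the hop condition written as a decidable disjunction) (from the hopping formula `OneMagnon.xxz_mulVec_apply`);
* `two_mul_star_dotProduct_xxz_mulVec`, `two_mul_norm_sq`: `2⟨ψ,H(Δ)ψ⟩` and `2‖ψ‖²` as sums over
  ordered pairs; `energy_le_test_pair`: the variational principle with a real symmetric pair test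
  vector;
* `raise_mulVec_pair_support`, `raise_mulVec_apply_single`, `condensate_eq_pair`:
  `S⁺_tot ψ` is a one-magnon vector with `(S⁺ψ)(e_k) = Σ_{x≠k} v_{kx}`, hence
  `Λ(ψ) = Re⟨ψ, S⁺_tot S⁻_tot ψ⟩ = Σ_k |Σ_{x≠k} v_{kx}|² + 2(|V|/2 − 2)‖ψ‖²`.

Toolkit for kernel statements in the first sector where the monotone-transport / concavity questions
are non-trivial on vertex-transitive graphs (census: concavity of `Λ` fails on the cycle `C₇` at
`N = 2`; exact certificates in the cell's HOME).  H. Tasaki (2020) §2.4, App. A.3.  No definition is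
introduced.
-/

set_option linter.dupNamespace false

noncomputable section

namespace Summit.HubbardSuperconductivity.HubbardSuperconductivity.Theorems.AnisotropyChord.TwoMagnon

open Matrix Complex Finset
open Literature.MathematicalPhysics.QuantumLattice
open Summit.HubbardSuperconductivity.HubbardSuperconductivity.Theorems.AnisotropyChord.OneMagnon

variable {V : Type*} [Fintype V] [DecidableEq V]

/-! ### Hops of pair configurations -/

omit [Fintype V] in
/-- `e_a ∘ swap_{xy} = e_{swap_{xy} a}`. [folklore] -/
theorem single_comp_swap (a x y : V) :
    ((Pi.single a (1 : Fin 2) : V → Fin 2) ∘ Equiv.swap x y) = Pi.single (Equiv.swap x y a) 1 := by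
  funext z
  simp only [Function.comp_apply, Pi.single_apply]
  by_cases h : z = Equiv.swap x y a
  · subst h; simp
  · rw [if_neg h, if_neg]
    intro h'
    exact h (by rw [← h', Equiv.swap_apply_self])

omit [Fintype V] in
/-- `(e_i + e_j) ∘ swap_{xy} = e_{s i} + e_{s j}`. [folklore] -/
theorem pair_comp_swap (i j x y : V) :
    ((Pi.single i (1 : Fin 2) + Pi.single j 1 : V → Fin 2) ∘ Equiv.swap x y) =
      Pi.single (Equiv.swap x y i) 1 + Pi.single (Equiv.swap x y j) 1 := by
  rw [← single_comp_swap i x y, ← single_comp_swap j x y]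
  rfl

omit [Fintype V] in
/-- The hop condition on a pair configuration: `(e_i+e_j)_x ≠ (e_i+e_j)_y` iff exactly one of `x, y`
lies in `{i, j}`. [folklore] -/
theorem pair_apply_ne_iff {i j : V} (hij : i ≠ j) (x y : V) :
    (Pi.single i (1 : Fin 2) + Pi.single j 1 : V → Fin 2) x ≠ (Pi.single i (1 : Fin 2) + Pi.single j 1 : V → Fin 2) y ↔
      ((x = i ∨ x = j) ∧ ¬ (y = i ∨ y = j) ∨ ¬ (x = i ∨ x = j) ∧ (y = i ∨ y = j)) := by
  rw [pair_apply hij, pair_apply hij]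
  by_cases hx : x = i ∨ x = j <;> by_cases hy : y = i ∨ y = j <;> simp [hx, hy]

variable (G : SimpleGraph V) [DecidableRel G.Adj]

/-- An edge sum of a symmetric function is half the ordered-pair sum. [folklore] -/
theorem sum_edgeFinset_lift_eq_half {M : Type*} [Field M] [CharZero M] (F : V → V → M)
    (hF : ∀ x y, F x y = F y x) :
    ∑ e ∈ G.edgeFinset, Sym2.lift ⟨F, hF⟩ e = (1 / 2) * ∑ x, ∑ y, (if G.Adj x y then F x y else 0) := by
  rw [sum_sum_ite_adj_eq_sum_edgeFinset, Finset.mul_sum]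
  refine Finset.sum_congr rfl fun e _ => ?_
  induction e using Sym2.ind with
  | h x y => simp only [Sym2.lift_mk]; rw [hF y x]; ring

/-- **`H(Δ)` on a pair configuration in pair coordinates**:
`(H(Δ)ψ)(e_i+e_j) = −Δ Z_{ij} ψ(e_i+e_j) − ¼ Σ_x Σ_y [x∼y][exactly one of x,y ∈ {i,j}] ψ(e_{s i} + e_{s j})`,
`s = swap_{xy}`, `Z_{ij} = |E|/4 − (d_i+d_j)/2 + [i∼j]`. [folklore] -/
theorem xxz_mulVec_pair (Δ : ℝ) (ψ : (V → Fin 2) → ℂ) {i j : V} (hij : i ≠ j) :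
    ((xxzHamiltonian 1 G (-1) Δ : Op V 2) *ᵥ ψ) (Pi.single i 1 + Pi.single j 1) =
      -((Δ * ((G.edgeFinset.card : ℝ) / 4 - ((G.degree i : ℝ) + (G.degree j : ℝ)) / 2
          + (if G.Adj i j then 1 else 0)) : ℝ) : ℂ) * ψ (Pi.single i 1 + Pi.single j 1)
        - (1 / 4 : ℂ) * ∑ x, ∑ y, (if G.Adj x y then
            (if ((x = i ∨ x = j) ∧ ¬ (y = i ∨ y = j) ∨ ¬ (x = i ∨ x = j) ∧ (y = i ∨ y = j)) then
              ψ (Pi.single (Equiv.swap x y i) 1 + Pi.single (Equiv.swap x y j) 1) else 0) else 0) := by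
  rw [xxz_mulVec_apply G Δ ψ, isingWeight_pair G hij _ rfl]
  congr 1
  rw [sum_edgeFinset_lift_eq_half]
  rw [← mul_assoc]
  congr 1
  · norm_num
  · refine Finset.sum_congr rfl fun x _ => Finset.sum_congr rfl fun y _ => ?_
    by_cases hadj : G.Adj x y
    · rw [if_pos hadj, if_pos hadj]
      by_cases hc : ((x = i ∨ x = j) ∧ ¬ (y = i ∨ y = j) ∨ ¬ (x = i ∨ x = j) ∧ (y = i ∨ y = j))
      · rw [if_pos ((pair_apply_ne_iff hij x y).mpr hc), if_pos hc, pair_comp_swap]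
      · rw [if_neg (fun h => hc ((pair_apply_ne_iff hij x y).mp h)), if_neg hc]
    · rw [if_neg hadj, if_neg hadj]

/-- **Energy in pair coordinates**: `2⟨ψ, H(Δ)ψ⟩ = Σ_i Σ_{j≠i} conj(v_{ij})·(H(Δ)ψ)(e_i+e_j)` for
`ψ` supported on weight-`2` configurations. [folklore] -/
theorem two_mul_star_dotProduct_xxz_mulVec (Δ : ℝ) {ψ : (V → Fin 2) → ℂ}
    (hψ : ∀ σ : V → Fin 2, (∑ z, (σ z : ℕ)) ≠ 2 → ψ σ = 0) :
    2 * (star ψ ⬝ᵥ ((xxzHamiltonian 1 G (-1) Δ : Op V 2) *ᵥ ψ)) =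
      ∑ i, ∑ j, (if i = j then 0 else
        star (ψ (Pi.single i 1 + Pi.single j 1)) *
          ((xxzHamiltonian 1 G (-1) Δ : Op V 2) *ᵥ ψ) (Pi.single i 1 + Pi.single j 1)) := by
  have h := two_smul_sum_eq_sum_pairs
    (f := fun σ => star (ψ σ) * ((xxzHamiltonian 1 G (-1) Δ : Op V 2) *ᵥ ψ) σ)
    (fun σ hσ => by simp only [hψ σ hσ, star_zero, zero_mul])
  rw [two_smul] at h
  rw [dotProduct, two_mul]
  exact h

/-- **Norm in pair coordinates**: `2‖ψ‖² = Σ_i Σ_{j≠i} |v_{ij}|²`. [folklore] -/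
theorem two_mul_norm_sq {ψ : (V → Fin 2) → ℂ}
    (hψ : ∀ σ : V → Fin 2, (∑ z, (σ z : ℕ)) ≠ 2 → ψ σ = 0) :
    2 * (star ψ ⬝ᵥ ψ).re =
      ∑ i, ∑ j, (if i = j then 0 else
        ((ψ (Pi.single i 1 + Pi.single j 1)).re ^ 2 + (ψ (Pi.single i 1 + Pi.single j 1)).im ^ 2)) := by
  have h := two_smul_sum_eq_sum_pairs (f := fun σ => star (ψ σ) * ψ σ)
    (fun σ hσ => by simp only [hψ σ hσ, star_zero, zero_mul])
  rw [two_smul] at h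
  rw [dotProduct, two_mul]
  have h' := congrArg Complex.re h
  rw [Complex.add_re] at h'
  simp only [Pi.star_apply] at h' ⊢
  rw [h', Complex.re_sum]
  refine Finset.sum_congr rfl fun i _ => ?_
  rw [Complex.re_sum]
  refine Finset.sum_congr rfl fun j _ => ?_
  split_ifs
  · simp
  · simp [Complex.mul_re]; ring

/-! ### The condensate -/

/-- `S⁺_tot ψ` of a two-magnon vector is supported on one-magnon configurations. [folklore] -/
theorem raise_mulVec_pair_support {ψ : (V → Fin 2) → ℂ}
    (hψ : ∀ σ : V → Fin 2, (∑ z, (σ z : ℕ)) ≠ 2 → ψ σ = 0)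
    (τ : V → Fin 2) (hτ : (∑ z, (τ z : ℕ)) ≠ 1) :
    ((totalSpin 1 0 + I • totalSpin 1 1 : Op V 2) *ᵥ ψ) τ = 0 := by
  rw [LiebMattis.raise_mulVec_apply 1 ψ τ]
  simp_rw [LiebMattis.sum_spinRaise_apply_mul 1 ψ τ]
  refine Finset.sum_eq_zero fun x _ => ?_
  by_cases hx : (τ x).val + 1 < 1 + 1
  · rw [dif_pos hx]
    have hx0 : (τ x : ℕ) = 0 := by omega
    have hw := weight_update τ x ⟨(τ x).val + 1, hx⟩
    have hval : ((⟨(τ x).val + 1, hx⟩ : Fin 2) : ℕ) = 1 := by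
      show (τ x).val + 1 = 1
      omega
    have hne : (∑ z, ((Function.update τ x ⟨(τ x).val + 1, hx⟩) z : ℕ)) ≠ 2 := by omega
    rw [hψ _ hne, mul_zero]
  · rw [dif_neg hx]

/-- **`S⁺_tot` in pair coordinates**: `(S⁺ψ)(e_k) = Σ_{x ≠ k} ψ(e_k + e_x)`. [folklore] -/
theorem raise_mulVec_apply_single {ψ : (V → Fin 2) → ℂ} (k : V) :
    ((totalSpin 1 0 + I • totalSpin 1 1 : Op V 2) *ᵥ ψ) (Pi.single k 1) =
      ∑ x, (if x = k then 0 else ψ (Pi.single k 1 + Pi.single x 1)) := by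
  rw [LiebMattis.raise_mulVec_apply 1 ψ _]
  simp_rw [LiebMattis.sum_spinRaise_apply_mul 1 ψ _]
  refine Finset.sum_congr rfl fun x _ => ?_
  by_cases hxk : x = k
  · subst hxk
    have hx : ¬ (((Pi.single x (1 : Fin 2) : V → Fin 2) x).val + 1 < 1 + 1) := by simp
    rw [dif_neg hx, if_pos rfl]
  · have hx : ((Pi.single k (1 : Fin 2) : V → Fin 2) x).val + 1 < 1 + 1 := by
      rw [Pi.single_eq_of_ne hxk]; simp
    rw [dif_pos hx, if_neg hxk]
    have h1 : (⟨((Pi.single k (1 : Fin 2) : V → Fin 2) x).val + 1, hx⟩ : Fin 2) = 1 :=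
      Fin.ext (by simp [Pi.single_eq_of_ne hxk])
    rw [h1]
    have hupd : Function.update (Pi.single k (1 : Fin 2) : V → Fin 2) x 1 = Pi.single k 1 + Pi.single x 1 := by
      funext z
      rw [pair_apply (Ne.symm hxk)]
      by_cases hzx : z = x
      · subst hzx; simp
      · rw [Function.update_of_ne hzx, Pi.single_apply]
        by_cases hzk : z = k
        · subst hzk; simp
        · simp [hzk, hzx]
    rw [hupd]
    have hval : ((Pi.single k (1 : Fin 2) : V → Fin 2) x : ℕ) = 0 := by rw [Pi.single_eq_of_ne hxk]; rfl
    simp [hval]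

/-- **The condensate in pair coordinates**:
`Λ(ψ) = Re⟨ψ, S⁺_tot S⁻_tot ψ⟩ = Σ_k |Σ_{x≠k} v_{kx}|² + 2(|V|/2 − 2)‖ψ‖²` for `ψ` in the two-magnon
sector. Tasaki (2020) App. A.3, eq. (A.3.6). [folklore] -/
theorem condensate_eq_pair {ψ : (V → Fin 2) → ℂ}
    (hψ : ψ ∈ spinZSector (Λ := V) 1 ((Fintype.card V : ℝ) / 2 - 2)) :
    (star ψ ⬝ᵥ (((∑ x, onSite x (spinRaise 1)) * (∑ y, onSite y (spinLower 1)) : Op V 2) *ᵥ ψ)).re =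
      ∑ k, ((∑ x, (if x = k then 0 else ψ (Pi.single k 1 + Pi.single x 1))).re ^ 2 +
             (∑ x, (if x = k then 0 else ψ (Pi.single k 1 + Pi.single x 1))).im ^ 2) +
        2 * ((Fintype.card V : ℝ) / 2 - 2) * (star ψ ⬝ᵥ ψ).re := by
  have hsupp := apply_eq_zero_of_mem_twoMagnonSector hψ
  rw [star_dotProduct_raiseLower_eq, LiebMattis.re_norm_lower_eq 1 hψ]
  congr 1
  -- `S⁺ψ` is a one-magnon vector: its norm in one-magnon coordinates
  rw [re_norm_eq (raise_mulVec_pair_support hsupp)]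
  refine Finset.sum_congr rfl fun k _ => ?_
  rw [raise_mulVec_apply_single]

/-! ### Real symmetric pair test vectors and the variational principle -/

/-- The real pair test vector `φ_y = Σ_{i≠j} (y_{ij}/2)|e_i+e_j⟩` vanishes off the weight-`2`
configurations. [folklore] -/
theorem testPair_apply_of_weight_ne (y : V → V → ℝ) (σ : V → Fin 2) (hσ : (∑ z, (σ z : ℕ)) ≠ 2) :
    (∑ i, ∑ j, (if i = j then (0 : (V → Fin 2) → ℂ) else
      ((y i j / 2 : ℝ) : ℂ) • Pi.single (Pi.single i (1 : Fin 2) + Pi.single j 1) (1 : ℂ))) σ = 0 := by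
  rw [Finset.sum_apply]
  refine Finset.sum_eq_zero fun i _ => ?_
  rw [Finset.sum_apply]
  refine Finset.sum_eq_zero fun j _ => ?_
  by_cases hij : i = j
  · rw [if_pos hij]; rfl
  · rw [if_neg hij, Pi.smul_apply, Pi.single_eq_of_ne, smul_zero]
    intro h
    exact hσ (h ▸ weight_pair hij)

/-- Value of the pair test vector at a pair configuration (for symmetric `y`): `φ_y(e_a+e_b) = y_{ab}`.
[folklore] -/
theorem testPair_apply_pair (y : V → V → ℝ) (hy : ∀ i j, y i j = y j i) {a b : V} (hab : a ≠ b) :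
    (∑ i, ∑ j, (if i = j then (0 : (V → Fin 2) → ℂ) else
      ((y i j / 2 : ℝ) : ℂ) • Pi.single (Pi.single i (1 : Fin 2) + Pi.single j 1) (1 : ℂ)))
        (Pi.single a 1 + Pi.single b 1) = (y a b : ℂ) := by
  rw [Finset.sum_apply]
  simp_rw [Finset.sum_apply]
  have hterm : ∀ i j : V, (if i = j then (0 : (V → Fin 2) → ℂ) else
      ((y i j / 2 : ℝ) : ℂ) • Pi.single (Pi.single i (1 : Fin 2) + Pi.single j 1) (1 : ℂ))
        (Pi.single a 1 + Pi.single b 1) =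
      (if i = a then (if j = b then ((y a b / 2 : ℝ) : ℂ) else 0) else 0)
        + (if i = b then (if j = a then ((y a b / 2 : ℝ) : ℂ) else 0) else 0) := by
    intro i j
    by_cases hij : i = j
    · subst hij
      rw [if_pos rfl, Pi.zero_apply]
      by_cases hia : i = a
      · subst hia; simp [hab]
      · simp [hia]
    · rw [if_neg hij, Pi.smul_apply, Pi.single_apply, smul_eq_mul]
      by_cases h : (Pi.single a (1 : Fin 2) + Pi.single b 1 : V → Fin 2) = Pi.single i 1 + Pi.single j 1
      · rw [if_pos h, mul_one]
        rcases (pair_eq_pair_iff hab hij).mp h with ⟨rfl, rfl⟩ | ⟨rfl, rfl⟩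
        · rw [if_pos rfl, if_pos rfl, if_neg hab, add_zero]
        · rw [if_neg (Ne.symm hab), zero_add, if_pos rfl, if_pos rfl, hy]
      · rw [if_neg h, mul_zero]
        have hne1 : ¬ (i = a ∧ j = b) := fun hh => h (by rw [hh.1, hh.2])
        have hne2 : ¬ (i = b ∧ j = a) := fun hh => h (by rw [hh.1, hh.2, pair_comm])
        by_cases hia : i = a
        · rw [if_pos hia, if_neg (fun hjb => hne1 ⟨hia, hjb⟩), zero_add]
          by_cases hib : i = b
          · exact absurd (hia.symm.trans hib) hab
          · rw [if_neg hib]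
        · rw [if_neg hia, zero_add]
          by_cases hib : i = b
          · rw [if_pos hib, if_neg (fun hja => hne2 ⟨hib, hja⟩)]
          · rw [if_neg hib]
  simp_rw [hterm]
  have hinner : ∀ i : V, ∑ j, ((if i = a then (if j = b then ((y a b / 2 : ℝ) : ℂ) else 0) else 0)
      + (if i = b then (if j = a then ((y a b / 2 : ℝ) : ℂ) else 0) else 0)) =
      (if i = a then ((y a b / 2 : ℝ) : ℂ) else 0) + (if i = b then ((y a b / 2 : ℝ) : ℂ) else 0) := by
    intro i
    by_cases hia : i = a
    · subst hia
      simp [hab]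
    · by_cases hib : i = b
      · subst hib
        simp [hia]
      · simp [hia, hib]
  rw [Finset.sum_congr rfl (fun i _ => hinner i), Finset.sum_add_distrib, Finset.sum_ite_eq', Finset.sum_ite_eq']
  simp only [Finset.mem_univ, if_true]
  push_cast
  ring

/-- **Variational principle with a pair test vector**: the sector energy times `‖φ_y‖²` is at most
`Re⟨φ_y, H(Δ)φ_y⟩` (`φ_y` lies in the two-magnon sector). [folklore] -/
theorem energy_le_testPair (Δ : ℝ) (y : V → V → ℝ) :
    lowestEnergyInSector 1 (xxzHamiltonian 1 G (-1) Δ) ((Fintype.card V : ℝ) / 2 - 2) *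
        (star (∑ i, ∑ j, (if i = j then (0 : (V → Fin 2) → ℂ) else
          ((y i j / 2 : ℝ) : ℂ) • Pi.single (Pi.single i (1 : Fin 2) + Pi.single j 1) (1 : ℂ))) ⬝ᵥ
          (∑ i, ∑ j, (if i = j then (0 : (V → Fin 2) → ℂ) else
          ((y i j / 2 : ℝ) : ℂ) • Pi.single (Pi.single i (1 : Fin 2) + Pi.single j 1) (1 : ℂ)))).re ≤
      (star (∑ i, ∑ j, (if i = j then (0 : (V → Fin 2) → ℂ) else
          ((y i j / 2 : ℝ) : ℂ) • Pi.single (Pi.single i (1 : Fin 2) + Pi.single j 1) (1 : ℂ))) ⬝ᵥ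
        ((xxzHamiltonian 1 G (-1) Δ : Op V 2) *ᵥ
          (∑ i, ∑ j, (if i = j then (0 : (V → Fin 2) → ℂ) else
          ((y i j / 2 : ℝ) : ℂ) • Pi.single (Pi.single i (1 : Fin 2) + Pi.single j 1) (1 : ℂ))))).re :=
  minEnergyOn_mul_le_re_rayleigh (xxzHamiltonian_isHermitian 1 G (-1) Δ) _
    (mem_twoMagnonSector_of_support (testPair_apply_of_weight_ne y))

end Summit.HubbardSuperconductivity.HubbardSuperconductivity.Theorems.AnisotropyChord.TwoMagnon
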